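import Literature.Topology.FourManifolds.NonSeparatingSpheresLoopLift
import Literature.Topology.FourManifolds.CircleLoops
import Literature.Topology.FourManifolds.TorusCoordinates
import Literature.Topology.FourManifolds.HCobordismAuxiliaryPairProofs
import Mathlib.Topology.Homotopy.Product
import HarnessLib

/-!
# Budney–Gabai Thm. 3.13: a loop of `S¹ × Sⁿ` of degree `d` is homotopic to the standard circle
# of degree `d`

Companion to `NonSeparatingSpheresLoopLift.lean` (lift `c̃ : ℝ → ℝ × Sⁿ` of a loop
`c : S¹ → S¹ × Sⁿ` with its degree `d`: `c̃ (θ + 2π) = τ_d c̃ (θ)`) and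
`NonSeparatingSpheresDegree.lean` (the dual circle of a non-separating sphere has degree `±1`),
for the fact seat of `Literature.Topology.FourManifolds.BudneyGabai2019_thm_3_13` (R. Budney,
D. Gabai, *Knotted 3-balls in `S⁴`*, arXiv:1912.09029, Thm. 3.13; proof, p. 22: *"we can isotope
our embedding to be equal to `S¹ × {*}`"* — by Whitney's theorem, once the dual circle is known
to be **homotopic** to `S¹ × {*}`).  Here the homotopy:

* `BudneyGabai2019_thm_3_13.homotopic_standardLoop_of_loopLift` — a loop `c` of `S¹ × Sⁿ`,
  `n ≥ 2`, with a lift of degree `d` is homotopic to the standard loop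
  `s ↦ (e^{ia} · ι(s)^d, p₀)` (`ι : S¹ ≅ Circle` the tree's `toCircle`, `a` the phase of the lift
  at `θ = 0`, `p₀ ∈ Sⁿ` arbitrary): the `S¹`-coordinate is deformed along
  `λ ↦ c₁(s) · e^{-iλ W(s)}`, where `W` is the `2π`-periodic defect `c̃₁ θ - dθ - a` of the lift
  descended to the circle, and the `Sⁿ`-coordinate by any homotopy to the constant `p₀`
  (`Sⁿ` is simply connected for `n ≥ 2`, so any two loops in it are homotopic —
  the tree's `ContinuousMap.homotopic_of_simplyConnectedSpace`).

Everything here is proved; no definition and no named fact is introduced.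

## References

* R. Budney, D. Gabai, *Knotted 3-balls in `S⁴`*, arXiv:1912.09029 (v2), §3, proof of Thm. 3.13
  (p. 22). [BudneyGabai2019]
* A. Hatcher, *Algebraic Topology*, CUP (2002), §1.1, Thm. 1.7 (`π₁(S¹) = ℤ` via degree),
  Prop. 1.14 (`π₁(Sⁿ) = 1`, `n ≥ 2`). [HatcherAT2002]
-/

noncomputable section

open scoped Manifold ContDiff Topology Real
open Set Function Metric

namespace Literature.Topology.FourManifolds

namespace BudneyGabai2019_thm_3_13

variable {n : ℕ}

/-- `toCircle (cos θ, sin θ) = e^{iθ}`. [folklore] -/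
theorem toCircle_circlePoint (θ : ℝ) : toCircle (circlePoint θ) = Circle.exp θ := by
  apply Circle.ext
  rw [coe_toCircle, Circle.coe_exp]
  apply Complex.ext
  · rw [toC_re, circlePoint_apply_zero, Complex.exp_ofReal_mul_I_re]
  · rw [toC_im, circlePoint_apply_one, Complex.exp_ofReal_mul_I_im]

/-- `toCircle : 𝕊¹ → Circle` is continuous. [folklore] -/
private theorem continuous_toCircle' : Continuous toCircle :=
  (contDiff_toC.continuous.comp continuous_subtype_val).subtype_mk _

/-- **A loop of `S¹ × Sⁿ` with a lift of degree `d` is homotopic to the standard loop of degree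
`d`.**  Let `c : S¹ → S¹ × Sⁿ` be continuous, `n ≥ 2`, with a continuous lift `c̃ : ℝ → ℝ × Sⁿ`
(`(exp × id) (c̃ θ) = c (cos θ, sin θ)`) satisfying `c̃ (θ + 2π) = ((c̃ θ)₁ + 2πd, (c̃ θ)₂)`.  Then,
for every `p₀ ∈ Sⁿ`, `c` is homotopic to (any continuous map `u` equal to)
`s ↦ (e^{ia} ι(s)^d, p₀)` with `a = (c̃ 0)₁` and `ι = toCircle : S¹ ≅ Circle` (Hatcher, *Algebraic Topology*, §1.1: circle maps of equal degree
are homotopic; Prop. 1.14: `Sⁿ` is simply connected for `n ≥ 2`).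
[cite: HatcherAT2002, §1.1 Thm. 1.7 and Prop. 1.14] -/
theorem homotopic_standardLoop_of_loopLift (hn : 2 ≤ n)
    (c : C(Metric.sphere (0 : EuclideanSpace ℝ (Fin 2)) 1,
      Circle × Metric.sphere (0 : EuclideanSpace ℝ (Fin (n + 1))) 1))
    {ct : ℝ → ℝ × Metric.sphere (0 : EuclideanSpace ℝ (Fin (n + 1))) 1} (hctc : Continuous ct)
    (hct : ∀ θ, (Prod.map Circle.exp id (ct θ) :
      Circle × Metric.sphere (0 : EuclideanSpace ℝ (Fin (n + 1))) 1) = c (circlePoint θ))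
    {d : ℤ} (hdeck : ∀ θ, ct (θ + 2 * π) = ((ct θ).1 + d * (2 * π), (ct θ).2))
    (p₀ : Metric.sphere (0 : EuclideanSpace ℝ (Fin (n + 1))) 1)
    (u : C(Metric.sphere (0 : EuclideanSpace ℝ (Fin 2)) 1,
      Circle × Metric.sphere (0 : EuclideanSpace ℝ (Fin (n + 1))) 1))
    (hu : ∀ s, u s = (Circle.exp ((ct 0).1) * toCircle s ^ d, p₀)) :
    c.Homotopic u := by
  set a : ℝ := (ct 0).1 with ha
  set g : ℝ → ℝ := fun θ ↦ (ct θ).1 with hg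
  have hgc : Continuous g := continuous_fst.comp hctc
  have hgexp : ∀ θ, Circle.exp (g θ) = (c (circlePoint θ)).1 := fun θ ↦ by
    have := congrArg Prod.fst (hct θ)
    simpa using this
  -- the periodic defect `w θ = g θ - d θ - a` and its descent `W` to the circle
  set w : ℝ → ℝ := fun θ ↦ g θ - d * θ - a with hw
  have hwc : Continuous w := (hgc.sub (continuous_const.mul continuous_id)).sub continuous_const
  have hwper : Periodic w (2 * π) := fun θ ↦ by
    simp only [hw, hg]
    rw [hdeck θ]
    dsimp only
    ring
  obtain ⟨W, hW⟩ := exists_fun_comp_circlePoint_eq hwper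
  have hWc : Continuous W := continuous_of_comp_circlePoint (by
    have : W ∘ circlePoint = w := funext hW
    rw [this]
    exact hwc)
  -- the two coordinates of `c`
  set c₁ : C(Metric.sphere (0 : EuclideanSpace ℝ (Fin 2)) 1, Circle) :=
    ⟨fun s ↦ (c s).1, continuous_fst.comp c.continuous⟩ with hc₁
  set c₂ : C(Metric.sphere (0 : EuclideanSpace ℝ (Fin 2)) 1,
      Metric.sphere (0 : EuclideanSpace ℝ (Fin (n + 1))) 1) :=
    ⟨fun s ↦ (c s).2, continuous_snd.comp c.continuous⟩ with hc₂
  -- the standard first coordinate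
  set u₁ : C(Metric.sphere (0 : EuclideanSpace ℝ (Fin 2)) 1, Circle) :=
    ⟨fun s ↦ Circle.exp a * toCircle s ^ d, continuous_const.mul (continuous_toCircle'.zpow d)⟩
    with hu₁
  set u₂ : C(Metric.sphere (0 : EuclideanSpace ℝ (Fin 2)) 1,
      Metric.sphere (0 : EuclideanSpace ℝ (Fin (n + 1))) 1) := ContinuousMap.const _ p₀ with hu₂
  -- ### homotopy of the first coordinates: `(λ, s) ↦ c₁ s · e^{-iλ W s}`
  have h₁ : c₁.Homotopic u₁ := by
    refine ⟨{ toFun := fun p ↦ c₁ p.2 * Circle.exp (-(p.1 : ℝ) * W p.2)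
              continuous_toFun := ?_
              map_zero_left := fun s ↦ ?_
              map_one_left := fun s ↦ ?_ }⟩
    · exact (c₁.continuous.comp continuous_snd).mul
        (Circle.exp.continuous.comp ((continuous_subtype_val.comp continuous_fst).neg.mul
          (hWc.comp continuous_snd)))
    · simp
    · obtain ⟨θ, rfl⟩ := circlePoint_surjective s
      simp only [Set.Icc.coe_one, neg_mul, one_mul, ContinuousMap.coe_mk, hc₁, hu₁]
      rw [← hgexp, hW, toCircle_circlePoint, ← Circle.exp_intCast_mul, ← Circle.exp_add,
        ← Circle.exp_add]
      congr 1
      simp only [hw]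
      ring
  -- ### homotopy of the second coordinates: `Sⁿ` is simply connected
  have h₂ : c₂.Homotopic u₂ := by
    haveI := simplyConnectedSpace_euclideanSphere hn
    exact ContinuousMap.homotopic_of_simplyConnectedSpace c₂ u₂
  obtain ⟨F⟩ := h₁
  obtain ⟨G⟩ := h₂
  -- `c = c₁.prodMk c₂` and the standard loop is `u₁.prodMk u₂`, definitionally
  have key : (c₁.prodMk c₂).Homotopic (u₁.prodMk u₂) := ⟨F.prod G⟩
  have e1 : c₁.prodMk c₂ = c := ContinuousMap.ext fun s ↦ rfl
  have e2 : u₁.prodMk u₂ = u := ContinuousMap.ext fun s ↦ by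
    rw [hu]
    rfl
  rw [e1, e2] at key
  exact key

end BudneyGabai2019_thm_3_13

end Literature.Topology.FourManifolds

end
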